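import Mathlib
import Summits.Langlands.Langlands.Theses.IrreducibilityBySelfDuality
import Literature.NumberTheory.Automorphic.ClozelAlgebraicity
import Literature.NumberTheory.Automorphic.GLOneOfHeckeCharacterBJ
import Literature.NumberTheory.Automorphic.GLnAdelicStructureProofs
import Literature.NumberTheory.Automorphic.JacquetLanglandsParts
import Literature.NumberTheory.GaloisRepresentations.HeckeLFunctionNonvanishingLineProofs
import Summits.Langlands.Langlands.Theorems.HeckeEigenvalueField.Negative.FalseWithoutIsRegularAlgebraic

/-!
# Disproof of `HeckeEigenvalueField` — findings (cdisprove seat, crux stmt-Langlands-13632, cycle 1)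

Crux (route `IrreducibilityBySelfDuality`, rank 1):
`Summit.Langlands.Langlands.Theses.IrreducibilityBySelfDuality.HeckeEigenvalueField`, which is
`Iff.rfl` the named fact `Literature.NumberTheory.Automorphic.Clozel1990_heckeEigenvalueField`
(Clozel 1990, Thm. 3.13 in Hecke-eigenvalue form): for `π` cuspidal regular algebraic on `GL_n(𝔸_K)`
(any `n`, any number field `K`) one number field `E ⊂ ℂ` contains `t_{v,i} = q_v^{i(n-i)/2} e_i(α_v)`
for every Satake parameter `α_v` at all but finitely many `v`, all `i ≤ n`.

## Verdict of cycle 1: NO KILL — the crux is Clozel's theorem, faithfully typed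

* **F1 (elaboration).** rc 0; `probe` in `W.lean`; crux `↔ Clozel1990_heckeEigenvalueField` by `Iff.rfl`.
* **F2 (normalisation audit — the only realistic falsity mode, per the planner's own flag).**
  `heckeOperator ρ U g = Σ_{yU ⊆ UgU} ρ(y)` (`HeckeAlgebra.lean`: INTEGRAL double-coset operator,
  counting normalisation); `HasSatakeParamAt v α` reads the eigenvalue of
  `[K(𝔫) diag(ϖ×i,1×(n-i)) K(𝔫)]`, `v(ϖ) = 1`, as `(√q_v)^{i(n-i)} e_i(α)` — this is the Satake–Tamagawa
  value on the UNITARILY normalised Satake parameter (checked by hand: `GL_1`: `χ(ϖ)`; `GL_2`: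
  `q^{1/2}(α+β)`, `αβ`; on the unitary `π_Δ`: `T_p ↦ τ(p)p^{-5} ∈ ℚ`). `IsRegularAlgebraic` =
  C-algebraic (`a, b ∈ (n-1)/2 + ℤ`) + regular = Clozel's "algébrique régulière"; the Harish-Chandra
  homomorphism behind `HasArchParameter` is the ρ-SHIFTED one (`HarishChandraHomGL.highestWeight`:
  `γ(z)(λ+ρ)`), CONSTRUCTED in tree (`nonempty_harishChandraHomGL_holds`, `harishChandraHomGL_unique_holds`),
  so the C/L dichotomy is the printed one (trivial rep ↦ `ρ`). A `t ↔ t⁻¹` / `ϖ ↔ ϖ⁻¹` slip would only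
  replace `α` by the contragredient parameter, to which the statement is insensitive. Conclusion: the
  item is Clozel Thm. 3.13 for C-algebraic regular cuspidal `π` VERBATIM; TRUE in print
  (Clozel 1990 §3.5; Patrikis 2019 Thm. 3.2.1 "any number field"; Böckle–Hui 2025 §3.1).
* **F3 (no junk model).** `CuspidalAutomorphicRepData` is an honest `W'/W ≤ 𝒜₀` datum; the only data
  constructible in tree today are on `GL_1` (Hecke characters, `GLOneOfHeckeCharacterBJ`), where the
  crux is PROVED (`heckeEigenvalueField_rank_one`, prover p82717 / `Clozel1990_heckeEigenvalueField.rank_one`).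
  `n = 0`: conclusion is `1 ∈ E`, trivially true. An in-tree refutation would need a cusp form on
  `GL_{n≥2}` with its archimedean parameter — not constructible; and the statement is true anyway.
* **F4 (load-bearing hypothesis, LANDED p100052).** `IsRegularAlgebraic` cannot be dropped:
  `heckeEigenvalueField_false_without_isRegularAlgebraic` below (witness: the cuspidal `GL_1/ℚ` datum of
  `‖·‖^s`, `s ∈ ℝ` with `q^{-s}` transcendental for all `q ≥ 2`; `t_{v,1} = N(v)^{-s}`). Sorry-free; tree
  copy `Summits/Langlands/Langlands/Theorems/HeckeEigenvalueField/Negative/FalseWithoutIsRegularAlgebraic.lean`.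
  Cuspidality cannot be tested separately (no non-cuspidal data constructible; in print it is needed:
  Eisenstein/residual C-algebraic `π` still have algebraic eigenvalues, so "cuspidal" is NOT
  load-bearing for the bare conclusion in print — information for the prover: Clozel's conjecture 3.8 /
  Franke for all C-algebraic automorphic `π`; only the PROOF (cuspidal cohomology) uses it).
* **F5 (tightness / natural strengthenings, print level, not built).** (i) `E = ℚ` is false in print
  (n = 1: order-`m` Dirichlet characters give `ζ_m`; n = 2: `S_24(SL_2 ℤ)` has Hecke field `ℚ(√144169)`);
  (ii) "one `E` for all `π` of given `(n, K)`" is false in print (same witnesses, `φ(m) → ∞`) — both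
  buildable at `n = 1` from `HeckeCharacter.exists_of_dirichletCharacter_holds` + the `GL_1` infinity-type
  dictionary (`GLOneArchParameterOfAlgebraicCharacter`) + Dirichlet's theorem, ~1 cycle, low value, parked;
  (iii) "at EVERY unramified `v`" instead of `∀ᶠ v`: TRUE in print (model of `π_f` over `E`) and proved in
  tree at `n = 1` — a legitimate sharpening, not a refutation target.
* **F6 (line `BaireSketch`, stubs).** S3 (pure field theory) is TRUE — proof sketch in the section
  `stubS3_analysis`; both of its countability hypotheses are load-bearing
  (`stub_S3_false_without_countable_subfield/_index`, proposal p102294); S4 is TRUE in print but `IsRegularAlgebraic` is load-bearing there too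
  (`stub_S4_false_without_isRegularAlgebraic`, LANDED in the same file p100052) and its formal cost hides
  a `K_∞`-type countability step — see the feasibility note `stubS4_feasibility` (a countable COFINAL
  family of `M`'s for `harishChandra_finiteness` from polynomial degree + smearing, avoiding Peter–Weyl);
  (ii) is clause (ii) of the vendored `Clozel1990_regularAlgebraic` (lead's `autConjugates_of_clozel1990`,
  kernel-checked); joint sufficiency `HeckeEigenvalueField_of` is kernel-checked (0 sorry) — no smuggled gap.
* **F7 (barriers / negatives).** `Literature/Barriers/Langlands/*` (ShimuraVarietyRealization,
  NonRegularWeight, …) concern constructing Galois representations / non-regular weights; none bites a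
  rationality statement for REGULAR C-algebraic `π`. `ledger negatives --problem Langlands`: no entry on
  Hecke fields.
* **F8 (targets).** `payload.stuck_stubs = []`, `targets = []` — nothing to kill this cycle.

WHY IT RESISTS: the crux is a 35-year-old theorem whose tree transcription passed the normalisation
audit (F2); every object the tree can construct (GL_1) satisfies it (proved); the negation would need
an explicit cusp form on GL_n, n ≥ 2, with transcendental normalised Hecke eigenvalues — which do not
exist for regular C-algebraic `π`.
-/

open scoped Classical
open Filter NumberField IsDedekindDomain
open Literature.NumberTheory.Automorphic Literature.NumberTheory.GaloisRepresentations

set_option linter.dupNamespace false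

namespace Summit.Langlands.Langlands.Cruxes.HeckeEigenvalueField.Disproof

/-! ## The witness family: the cuspidal `GL(1)` data of the norm powers `‖·‖^z`
(LANDED, p100052 — `Theorems/HeckeEigenvalueField/Negative/FalseWithoutIsRegularAlgebraic.lean`; the
declarations below are re-exports by name so that readers of this work file see the statements.) -/

/-- **Norm-power data on `GL(1)`** (re-export of the landed
`Negative.exists_cuspidal_glOne_normPow`). For every number field `K`, level witness `hcpt` and
`z ∈ ℂ`, the Borel–Jacquet datum `π_z = ℂ·(‖det‖^z)/⊥` of the Hecke character `‖·‖^z` is CUSPIDAL and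
has Satake parameter `{N(v)^{-z}}` at all but finitely many finite places. This family is the
universal counterexample engine of this file: unramified everywhere, level `1`, `Z(𝔤)`-finite, and
its eigensystem `v ↦ N(v)^{-z}` moves continuously with `z`. [folklore] -/
theorem exists_cuspidal_glOne_normPow (K : Type) [Field K] [NumberField K]
    (hcpt : isCompact_glFiniteIntegralLevel 1 K) (z : ℂ) :
    ∃ π : CuspidalAutomorphicRepData 1 K hcpt,
      ∀ᶠ v : HeightOneSpectrum (𝓞 K) in cofinite,
        π.1.HasSatakeParamAt v {((Ideal.absNorm v.asIdeal : ℕ) : ℂ) ^ (-z)} :=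
  Summit.Langlands.Langlands.Theorems.HeckeEigenvalueField.Negative.exists_cuspidal_glOne_normPow K hcpt z

/-- **A real exponent `s` with `q^{-s}` transcendental for every integer `q ≥ 2`** (re-export).
[folklore] -/
theorem exists_real_forall_not_isAlgebraic_rpow :
    ∃ s : ℝ, ∀ q : ℕ, 2 ≤ q → ¬ IsAlgebraic ℚ ((((q : ℝ) ^ (-s) : ℝ)) : ℂ) :=
  Summit.Langlands.Langlands.Theorems.HeckeEigenvalueField.Negative.exists_real_forall_not_isAlgebraic_rpow

/-! ## (a) Load-bearing analysis: `IsRegularAlgebraic` cannot be dropped -/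

/-- The crux `HeckeEigenvalueField` with its only hypothesis `π.1.IsRegularAlgebraic` DELETED
(text otherwise verbatim). -/
def HeckeEigenvalueFieldWithoutIsRegularAlgebraic : Prop :=
  ∀ (n : ℕ) (K : Type) [Field K] [NumberField K] (hcpt : _)
    (π : Literature.NumberTheory.Automorphic.CuspidalAutomorphicRepData n K hcpt),
    ∃ E : Subfield ℂ, FiniteDimensional ℚ E ∧ ∀ᶠ v in cofinite, ∀ α : Multiset ℂ,
      π.1.HasSatakeParamAt v α → ∀ i ≤ n,
        ((((Real.sqrt (v.residueCard : ℝ)) : ℝ) : ℂ) ^ (i * (n - i))) * α.esymm i ∈ E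

/-- **Any proof of the crux must use `IsRegularAlgebraic`** (LANDED sorry-free as
`Summit.Langlands.Langlands.Theorems.HeckeEigenvalueField.Negative.heckeEigenvalueField_false_without_isRegularAlgebraic`,
p100052): without it the statement fails
already for `n = 1`, `K = ℚ`, at the cuspidal datum of `‖·‖^s` with `s` real and `q^{-s}`
transcendental for every `q ≥ 2` — its Hecke eigenvalue at every unramified `v` is
`t_{v,1} = N(v)^{-s}`, which lies in no number field. (The `|det|^s`-twist obstruction of
Clozel 1990, §1 / Buzzard–Gee 2014, §3.1, realised in the tree's Borel–Jacquet `GL(1)` model.)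
[folklore] -/
theorem heckeEigenvalueField_false_without_isRegularAlgebraic :
    ¬ HeckeEigenvalueFieldWithoutIsRegularAlgebraic :=
  Summit.Langlands.Langlands.Theorems.HeckeEigenvalueField.Negative.heckeEigenvalueField_false_without_isRegularAlgebraic

/-! ### Other hypotheses of the crux (print-level analysis; nothing constructible to test in tree)
* `cuspidal` (`π.W ≤ 𝒜₀`): NOT load-bearing for the bare conclusion in print — every C-algebraic
  automorphic `π` is expected (and for regular ones known via Franke + Clozel) to have `π_f` defined
  over a number field; only Clozel's PROOF (cuspidal cohomology, §3.5) uses cuspidality. No non-cuspidal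
  `AutomorphicRepData` is constructible in the tree (Eisenstein series absent), so no lemma.
* `regular` inside `IsRegularAlgebraic`: NOT load-bearing for the statement in print either (Clozel's
  Conjecture 3.8(ii)/4.5: all C-algebraic cuspidal `π` are C-arithmetic; known for `GL_2/ℚ` weight one by
  Deligne–Serre), but load-bearing for every known PROOF when `n ≥ 2`. At `n = 1` regularity is automatic.
  So a prover may not hope to find slack here: the item is exactly as hard as Clozel 3.13.
* `C-algebraic` ↦ `L-algebraic`: FALSE in print for even `n` (unitary `π` of a weight-3 newform:
  `t_{p,1} = a_p/√p`), equivalent for odd `n` (`(n-1)/2 ∈ ℤ`); not testable in tree (no `GL_2` datum). -/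

/-! ## Line `BaireSketch` (lead prover-line-stmt-Langlands-13632-0; skeleton `Lines/BaireSketch.lean`)

### `stubS3_analysis` — stub (S3) is TRUE (pure field theory; no attack surface)
`∀ M ⊆ ℂ` countable subfield, `∀ a : ι → ℂ` countable family, `∃ σ ∈ Aut(ℂ/ℚ)` with `σ(a v) ∉ M` for
every transcendental `a v`.  Proof sketch (for the prover): let `F ⊆ ℂ` be the algebraic closure of
`ℚ(M ∪ range a)` (countable, algebraically closed, `⊇ ℚ̄`); pick a transcendence basis `B` of `F/ℚ̄` and
`B' ⊆ ℂ` algebraically independent OVER `F` with `#B' = #B` (`trdeg ℂ/F = 𝔠`); `F' :=` algebraic closure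
of `ℚ̄(B')`. Then `F ∩ F' = ℚ̄` (an `x ∈ F` algebraic over `ℚ̄(B')` satisfies `P(x, b') = 0`; independence
of `B'` over `F ∋ x` kills every coefficient `p_j(x)`, `p_j ∈ ℚ̄[X]`, so `x ∈ ℚ̄`), `F ≃ₐ[ℚ̄] F'`
(same transcendence degree), and the isomorphism extends to `σ ∈ Aut(ℂ)` (both sides algebraically
closed of countable size: the tree's `Literature.FieldTheory.AlgClosed.AutomorphismExtension`). For
transcendental `a v ∈ F ∖ ℚ̄`, `σ(a v) ∈ F' ∖ ℚ̄`, hence `∉ F ⊇ M`.  Degenerate cases: all `a v` algebraic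
(σ = 1); `M ∋` transcendentals (covered, `M ⊆ F`).  VERDICT: keep; size M (transcendence bases in
Mathlib: `exists_isTranscendenceBasis`, `IsTranscendenceBasis.isAlgebraic`; cardinal bookkeeping is the
work).

### `stubS4_feasibility` — stub (S4) is TRUE in print; `IsRegularAlgebraic` is load-bearing
(`stub_S4_false_without_isRegularAlgebraic` below, LANDED p100052); hidden cost = `K_∞`-type countability
The natural proof: `𝒞 := ⋃ Weights(unramified Hecke algebra ↷ V(K(𝔫), (ker θ_T)^m, M))` over levels
`𝔫`, exponents `m`, regular algebraic infinity types `T` (countable: `a ∈ (n-1)/2+ℤ`, finitely many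
embeddings; `θ_T` pinned by `HasArchParameter` + `harishChandraHomGL_unique_holds`) and the `K_∞`-datum
`M` of `harishChandra_finiteness` (a finite-dimensional right-stable `M ≤ (Kinf n K → ℂ)` containing the
slices `k ↦ φ(gk)`).  The set of ALL such `M` is uncountable; S4 needs a COUNTABLE COFINAL sub-family.
Peter–Weyl (countably many `K_∞`-types) is NOT in Mathlib/tree.  Workaround that the tree CAN support
(`CompactGroupKFiniteVectors`: `isTranslationFinite_coordFun`, `separatesPoints_translationFiniteSubalgebra`,
`smear`): take `M_j :=` the right-stable span of polynomials of degree `≤ j` in the real coordinates of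
the matrix entries of `K_∞` (finite-dimensional, right-stable since `(k k₀)_{ab}` is linear in `k`), and
replace the eigenform `φ ∈ W ∖ W'` by a smear `R(ψ)φ = ∫_{K_∞} ψ(k) R(k)φ dk` with `ψ` polynomial: its
slices `k ↦ ∫ ψ(k⁻¹k'') φ(g k'') dk''` lie in `M_j` (`k⁻¹ = k*` on `O(n) × U(n)`), it stays in `W`
(finite-dimensional `K_∞`-span of `φ`), `K(𝔫)`-fixed and Hecke-eigen mod `W'` (everything commutes with
`R(K_∞)`), and `R(ψ)φ ∉ W'` for SOME polynomial `ψ` by Stone–Weierstrass density + an approximate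
identity in the finite-dimensional space `span(R(K_∞)φ)`.  The `θ_T`-primary component of `φ` (CRT in
the cyclic `Z(𝔤)`-module `Z(𝔤)φ`, using that `Z(𝔤)` acts on `W/W'` by `θ_T`) is killed by `(ker θ_T)^m`
and is still `∉ W'`.  Then `c_π ∈ Weights(V)` with `V` finite-dimensional by `harishChandra_finiteness_holds`
and Hecke-stable.  Every index is countable ⇒ S4.  Estimated 5–7 stubs (Hecke-stability of `V`;
`Z(𝔤)`-primary projection; smear bookkeeping; weights of a commutative algebra on a finite-dimensional
space are finite — `Module.End.eigenvalues` finite).  RISK: medium-high FORMAL cost, no mathematical risk.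

### stub (ii) `stub_autConjugates` = clause (ii) of `Clozel1990_regularAlgebraic` (vendored named fact,
unproved in tree for `n ≥ 2`; `n = 1` proved: `exists_cuspidal_isAutConjugate_rank_one`).  The line
therefore closes the crux CONDITIONALLY on that fact — by design (PICKED.md).  No attack: it is Clozel's
theorem; `IsAutConjugate` conjugates the INTEGRAL eigenvalues `t_{v,i}` (not `α`), the correct rendering
(conjugating `α` itself would be false for even `n`: `σ(√p) = ±√p` sign patterns are uncountable).

### Joint sufficiency: `HeckeEigenvalueField_of : stub_S3 → stub_S4 → stub_autConjugates → crux` is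
kernel-checked in the skeleton (0 sorry, std axioms) — no gap smuggled by the glue.
-/

/-! ### (S4) minus `IsRegularAlgebraic` is false -/

/-- Stub (S4) of line `BaireSketch` (`stub_S4`: countably many cofinite germs of unramified Hecke
eigensystems) with the hypothesis `π.1.IsRegularAlgebraic` DELETED (text otherwise verbatim). -/
def S4WithoutIsRegularAlgebraic : Prop :=
  ∀ (n : ℕ) (K : Type) [Field K] [NumberField K]
    (hcpt : isCompact_glFiniteIntegralLevel n K),
    ∃ 𝒞 : Set (HeightOneSpectrum (𝓞 K) × Fin (n + 1) → ℂ), 𝒞.Countable ∧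
      ∀ π : CuspidalAutomorphicRepData n K hcpt,
        ∃ c ∈ 𝒞, ∀ᶠ v in cofinite, ∀ α : Multiset ℂ, π.1.HasSatakeParamAt v α →
          ∀ i : Fin (n + 1), heckeEigenvalueOf n v α i = c (v, i)

/-- **(S4) needs `IsRegularAlgebraic`**: without it the germs are UNCOUNTABLE already for
`n = 1`, `K = ℚ` — the data of `‖·‖^s`, `s ∈ ℝ`, have eigensystems `v ↦ N(v)^{-s}` that are
pairwise distinct at EVERY place, so `s ↦` (the member of `𝒞` shadowing `π_s`) is an injection
of `ℝ` into a countable set. Any proof of `stub_S4` must therefore route the algebraicity of the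
infinity type into the countability (e.g. through the infinitesimal character, as the line
intends); Harish-Chandra finiteness at a FIXED ideal of `Z(𝔤)` alone does not bound the family.
[folklore] -/
theorem stub_S4_false_without_isRegularAlgebraic : ¬ S4WithoutIsRegularAlgebraic :=
  Summit.Langlands.Langlands.Theorems.HeckeEigenvalueField.Negative.stub_S4_false_without_isRegularAlgebraic

/-! ### (S3): both countability hypotheses are load-bearing (proposal p102294,
`Theorems/HeckeEigenvalueField/Negative/StubS3Hypotheses.lean`; copies here until it lands) -/

/-- **(S3) needs `#M ≤ ℵ₀`.** With `M = ⊤` and a single transcendental value the conclusion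
`σ (a v) ∉ M` is impossible. [folklore] -/
theorem stub_S3_false_without_countable_subfield :
    ¬ ∀ (M : Subfield ℂ) (ι : Type) [Countable ι] (a : ι → ℂ),
        ∃ σ : ℂ ≃ₐ[ℚ] ℂ, ∀ v, Transcendental ℚ (a v) → σ (a v) ∉ M := by
  intro h
  obtain ⟨s, hs⟩ := exists_real_forall_not_isAlgebraic_rpow
  obtain ⟨σ, hσ⟩ := h ⊤ Unit (fun _ => ((((2 : ℕ) : ℝ) ^ (-s) : ℝ) : ℂ))
  exact hσ () (hs 2 le_rfl) (Subfield.mem_top _)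

/-- **(S3) needs `Countable ι`.** With `M = ℚ(τ)` for a transcendental `τ` (a countable subfield) and the
uncountable family `a = id : ℂ → ℂ`, every `σ ∈ Aut(ℂ/ℚ)` moves the transcendental `σ⁻¹ τ` into `M`.
[folklore] -/
theorem stub_S3_false_without_countable_index :
    ¬ ∀ (M : Subfield ℂ), Cardinal.mk M ≤ Cardinal.aleph0 →
        ∀ (ι : Type) (a : ι → ℂ),
          ∃ σ : ℂ ≃ₐ[ℚ] ℂ, ∀ v, Transcendental ℚ (a v) → σ (a v) ∉ M := by
  intro h
  obtain ⟨s, hs⟩ := exists_real_forall_not_isAlgebraic_rpow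
  set τ : ℂ := (((((2 : ℕ) : ℝ) ^ (-s) : ℝ)) : ℂ) with hτdef
  have hτ : Transcendental ℚ τ := hs 2 le_rfl
  have hM : Cardinal.mk (Subfield.closure ({τ} : Set ℂ)) ≤ Cardinal.aleph0 := by
    refine (Subfield.cardinalMk_closure_le_max ({τ} : Set ℂ)).trans ?_
    refine max_le ?_ le_rfl
    rw [Cardinal.mk_singleton]
    exact Cardinal.one_le_aleph0
  obtain ⟨σ, hσ⟩ := h (Subfield.closure {τ}) hM ℂ id
  refine hσ (σ.symm τ) ?_ ?_
  · intro halg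
    apply hτ
    simpa using halg.algHom (σ : ℂ →ₐ[ℚ] ℂ)
  · change σ (σ.symm τ) ∈ Subfield.closure ({τ} : Set ℂ)
    rw [AlgEquiv.apply_symm_apply]
    exact Subfield.subset_closure rfl

end Summit.Langlands.Langlands.Cruxes.HeckeEigenvalueField.Disproof

/-!
## Targets (lead's stuck stubs)
None this cycle (`payload.stuck_stubs = []`).

## HANDOFF (cdisprove seat)
* Landed: p100052 `Theorems/HeckeEigenvalueField/Negative/FalseWithoutIsRegularAlgebraic.lean`
  (`heckeEigenvalueField_false_without_isRegularAlgebraic`, `stub_S4_false_without_isRegularAlgebraic`,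
  witness family `exists_cuspidal_glOne_normPow`).
* Pending: p102294 `Theorems/HeckeEigenvalueField/Negative/StubS3Hypotheses.lean` (S3 countability hypotheses).
* Sorried here: nothing.
* Next regimes if re-armed: (1) F5(i)/(ii) at `n = 1` (Dirichlet characters: `E ≠ ℚ`, no uniform `E`);
  (2) if the lead registers S4 sub-stubs, attack each `_without_` hypothesis with the norm-power family
  (level, `Z(𝔤)`-ideal and `M` are all NECESSARY: dropping `(ker θ)^m` lets `‖·‖^s` in again);
  (3) if a `GL_2` datum ever becomes constructible (Eisenstein series / CM forms), test F2 at even `n`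
  (the ρ-shift) directly.
-/
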